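import Literature.NumberTheory.LFunctions.Zhang2022.RepairPairFormGram
import Literature.NumberTheory.LFunctions.Zhang2022.RepairSection9Boxes

/-!
# Zhang (2022), repair rung F-S1R, Q3-annex: the LENGTH knife edge — Zhang's own `H₁₂`-piece, 4 % longer than `P`

Y. Zhang, *Discrete mean estimates and the Landau–Siegel zero*, arXiv:2211.02515v1 [Zhang2022LandauSiegel] —
an unrefereed manuscript under adjudication; **nothing here asserts any of its claims, and nothing here is a
statement about Landau–Siegel zeros.** Repair rung of the cell (human ruling D-0077), lever L10 of
`repair/LEVERS.md` («lengths») — a kernel EXHIBIT, not an ingredient of the verdict.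

**The object.** Formula I of the manuscript (Prop 7.1 with Lemmas 8.2/8.4; `RepairFormulaIGram.Mform`) is the
main-order constant of `Θ₁(a_g, a_{h̄})/(𝔞𝔓)` for coefficient profiles supported on `n ≤ P`, i.e. on
`y = log n/log P ∈ [0,1]`: integrals over `[0,1]`, tail `∫_y^1 h`. Here the upper limit is a PARAMETER:
`MformTop T` has `∫₀^T` and tail `∫_y^T` (`MformTop_one : MformTop 1 = Mform` by `rfl` — the top-`1` form IS
formula I of record). For the mollifier piece `ϰ_{ν,k}(y) = (1 − y/ν)e^{iπk(ν−y)}𝟙_{y≤ν}`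
(`RepairKappaProfile.kappaP`, (2.23)–(2.25)) of ANY length `ν > 0` and any top `T ≥ ν` the diagonal value is the
tree's integral-defined `bDiagR k ν` of `RepairFrakc12Theta` (`MformTop_kappaP_diag`; at `T = 1 ≥ ν` this is
`RepairPairFormGram.Mform_kappaP_diag`). **Validity caveat (stated, not hidden):** as an off-diagonal-free MAIN
TERM of the discrete mean, formula I is proved in the manuscript only for lengths `< P` (`ν < 1`, Prop 7.1's
range `PT⁻²`); for `ν > 1`, `MformTop ν (ϰ,ϰ)` is the SAME diagonal calculus continued past `P` — what a
«longer mollifier» repair would have to use if no off-diagonal main term entered.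

**The exhibit** (theory seat's datum, `repair/theory/kappa_len.py`). With `𝔅♯(k,ν) := M_ν(ϰ,ϰ) + conj M_ν(ϰ,ϰ)`
on `ϰ = ϰ_{ν,k}` (`kappaDiagTop`; `= cDiagR k ν`; for `ν ≤ 1` it is `𝔅(ϰ_{ν,k}) ≥ 0`, the PSD main-term form
of `MainTermFormPSD`: `kappaDiagTop_eq_mainTermForm`, `kappaDiagTop_re_nonneg_of_le_one`):
`lengthKnifeEdge_witness`: **`−0.04313 < 𝔅♯(5/2, 21/20) < −0.04311`** — ONE piece of the printed `H₁₂`-shape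
(twist `k₇ = 5/2`), `4 %` longer than `P` in the logarithmic scale, has a NEGATIVE continued diagonal main term
(theory: `−0.0431`, sign change at `ν ≈ 1.0407`). Controls: `lengthKnifeEdge_control_one`
(`0.19203 < 𝔅(ϰ_{1,5/2}) < 0.19204`, a genuine `𝔅`-value), `kappaDiagTop_half_eq_c22` (`𝔅♯(5/2, 1/2) = c₂₂`,
the printed (8.20) constant), `lengthKnifeEdge_more` (`> 0` at `ν = 51/50`; `< 0` at `11/10, 5/4, 2`),
`lengthKnifeEdge_near` (`< −0.028` for EVERY `ν ∈ [1.049, 1.051]`, one interval box). So the positivity behind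
«not repairable in class» (`RepairPairFormGram`, `MainTermFormCauchySchwarz.not_closing_of_isH1`) holds exactly
up to length `P` and not `4 %` beyond: a repair by LENGTH needs the off-diagonal main term there (E*-len of
`repair/ESTAR.md`, open in print). Certificates: boxes `cDiagBL`/`mem_cDiagBL` of `RepairSection9Boxes` (valid at
every real `ν`), `decide +kernel`. No new `Prop` facts; axioms standard.
-/

noncomputable section

open Complex Real ComplexConjugate Set MeasureTheory intervalIntegral
open Literature.Analysis.ValidatedNumerics.Numerics

namespace Literature.NumberTheory.LFunctions.Zhang2022

namespace Repair

/-! ### Formula I with a free upper limit -/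

/-- One `j`-summand of formula I with the upper limit `T` as a parameter:
`(g′ + iπj g)(y) · conj[h′ + iπS_j h + π²N_j ∫_y^T h](y)` (`T = 1`: `dipoleIntegrand`).
[cite: Zhang2022LandauSiegel, Prop 7.1, Lemmas 8.2/8.4] -/
def dipoleIntegrandTop (T : ℝ) (j : ℕ) (g g' h h' : ℝ → ℂ) (y : ℝ) : ℂ :=
  (g' y + I * π * (j : ℂ) * g y)
    * conj (h' y + I * π * ((bS j : ℝ) : ℂ) * h y + (π : ℂ) ^ 2 * ((bN j : ℝ) : ℂ) * ∫ t in y..T, h t)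

/-- **Formula I with top `T`**: `M_T(g,h) = (1/π) Σ_j W_j ∫₀^T (g′+iπb_jg)·conj(h′+iπS_jh+π²N_j∫_y^Th)`,
`W = (1/2, 2, 3/2)`; `M_1 = Mform` (`MformTop_one`); on pieces of length `ν ≤ 1`, `T ≥ ν`, it equals `Mform`
(`MformTop_kappaP_diag_eq_Mform`); for `ν > 1` it is Prop 7.1's diagonal calculus continued past `P` (NOT
proved to be a main term there). [cite: Zhang2022LandauSiegel, Prop 7.1, (8.11)–(8.12)] -/
def MformTop (T : ℝ) (g g' h h' : ℝ → ℂ) : ℂ :=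
  (((1 / π : ℝ)) : ℂ) *
    (1 / 2 * (∫ y in (0:ℝ)..T, dipoleIntegrandTop T 1 g g' h h' y)
      + 2 * (∫ y in (0:ℝ)..T, dipoleIntegrandTop T 2 g g' h h' y)
      + 3 / 2 * (∫ y in (0:ℝ)..T, dipoleIntegrandTop T 3 g g' h h' y))

/-- **Faithfulness: `M_1 = M`**, the top-`1` form is formula I of record (`RepairFormulaIGram.Mform`).
[cite: Zhang2022LandauSiegel, Prop 7.1, (8.11)–(8.12)] -/
theorem MformTop_one (g g' h h' : ℝ → ℂ) : MformTop 1 g g' h h' = Mform g g' h h' := rfl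

/-! ### The tail integral of `ϰ` with a free top -/

section Tail

variable {ν k T : ℝ}

/-- The primitive of `ϰ` on its support: `G(t) = (1/ν)e^{iπk(ν−t)}(i(ν−t)/(πk) − 1/(π²k²))`.
[cite: Zhang2022LandauSiegel, (2.23)–(2.25) p.9] -/
private def kappaPrimT (ν k t : ℝ) : ℂ :=
  (((1 / ν : ℝ)) : ℂ) * (cexp ((k : ℂ) * π * I * ((ν - t : ℝ) : ℂ))
      * (I * ((ν - t : ℝ) : ℂ) / ((π : ℂ) * k) - 1 / ((π : ℂ) * k) ^ 2))

/-- `G′(t) = (1 − t/ν)e^{iπk(ν−t)}` (`k ≠ 0`). [cite: Zhang2022LandauSiegel, (2.23)–(2.25) p.9] -/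
private theorem hasDerivAt_kappaPrimT (hν : ν ≠ 0) (hk : k ≠ 0) (t : ℝ) :
    HasDerivAt (kappaPrimT ν k)
      ((((1 - t / ν : ℝ)) : ℂ) * cexp ((k : ℂ) * π * I * ((ν - t : ℝ) : ℂ))) t := by
  have hπ : (π : ℂ) ≠ 0 := by exact_mod_cast Real.pi_ne_zero
  have hν' : (ν : ℂ) ≠ 0 := by exact_mod_cast hν
  have hk' : (k : ℂ) ≠ 0 := by exact_mod_cast hk
  have h1 : HasDerivAt (fun x : ℝ => ((ν - x : ℝ) : ℂ)) (-1) t := by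
    have := ((hasDerivAt_id t).const_sub ν).ofReal_comp
    simpa using this
  have hE : HasDerivAt (fun x : ℝ => cexp ((k : ℂ) * π * I * ((ν - x : ℝ) : ℂ)))
      (cexp ((k : ℂ) * π * I * ((ν - t : ℝ) : ℂ)) * ((k : ℂ) * π * I * (-1))) t :=
    (h1.const_mul ((k : ℂ) * π * I)).cexp
  have hL : HasDerivAt (fun x : ℝ => I * ((ν - x : ℝ) : ℂ) / ((π : ℂ) * k) - 1 / ((π : ℂ) * k) ^ 2)
      (I * (-1) / ((π : ℂ) * k)) t := by
    have := ((h1.const_mul I).div_const ((π : ℂ) * k)).sub_const (1 / ((π : ℂ) * k) ^ 2)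
    simpa using this
  have h := (hE.mul hL).const_mul (((1 / ν : ℝ)) : ℂ)
  refine h.congr_deriv ?_
  push_cast
  field_simp
  linear_combination (-(↑k : ℂ) * ↑π * ↑ν + ↑k * ↑π * ↑t) * Complex.I_sq

/-- `∫_y^ν ϰ_{ν,k} = kappaTail ν k y` for `y ≤ ν` — ANY `ν ≠ 0` (fundamental theorem of calculus).
[cite: Zhang2022LandauSiegel, (2.23)–(2.25) p.9] -/
theorem integral_kappaP_self (hν : ν ≠ 0) (hk : k ≠ 0) {y : ℝ} (hy : y ≤ ν) :
    ∫ t in y..ν, kappaP ν k t = kappaTail ν k y := by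
  have e : ∫ t in y..ν, kappaP ν k t
      = ∫ t in y..ν, (((1 - t / ν : ℝ)) : ℂ) * cexp ((k : ℂ) * π * I * ((ν - t : ℝ) : ℂ)) := by
    refine intervalIntegral.integral_congr fun t ht => ?_
    rw [uIcc_of_le hy] at ht
    exact kappaP_of_le ht.2
  rw [e, intervalIntegral.integral_eq_sub_of_hasDerivAt (fun t _ => hasDerivAt_kappaPrimT hν hk t)
    ((Continuous.intervalIntegrable (by fun_prop) _ _))]
  unfold kappaPrimT kappaTail
  push_cast
  simp only [sub_self, mul_zero, Complex.exp_zero, zero_div, zero_sub, one_mul]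
  ring

/-- `∫_y^T ϰ_{ν,k} = 0` for `ν ≤ y ≤ T`. [cite: Zhang2022LandauSiegel, (2.23)–(2.25) p.9] -/
theorem integral_kappaP_top_of_ge (hν : 0 < ν) {y : ℝ} (hy : ν ≤ y) (hyT : y ≤ T) :
    ∫ t in y..T, kappaP ν k t = 0 := by
  rw [← intervalIntegral.integral_zero]
  refine intervalIntegral.integral_congr fun t ht => ?_
  rw [uIcc_of_le hyT] at ht
  exact kappaP_of_ge hν.ne' (hy.trans ht.1)

/-- `∫_y^T ϰ_{ν,k} = kappaTail ν k y` for `y ≤ ν ≤ T` (the profile vanishes on `[ν, T]`; `T = 1` is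
`RepairKappaProfile.integral_kappaP_tail`). [cite: Zhang2022LandauSiegel, (2.23)–(2.25) p.9] -/
theorem integral_kappaP_top (hk : k ≠ 0) (hν : 0 < ν) (hT : ν ≤ T) {y : ℝ} (hy : y ≤ ν) :
    ∫ t in y..T, kappaP ν k t = kappaTail ν k y := by
  have hc : Continuous fun t : ℝ =>
      (((1 - t / ν : ℝ)) : ℂ) * cexp ((k : ℂ) * π * I * ((ν - t : ℝ) : ℂ)) := by fun_prop
  have hi1 : IntervalIntegrable (kappaP ν k) volume y ν :=
    (hc.intervalIntegrable y ν).congr_uIoo fun t ht => by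
      rw [uIoo_of_le hy] at ht; exact (kappaP_of_le ht.2.le).symm
  have hi2 : IntervalIntegrable (kappaP ν k) volume ν T :=
    (intervalIntegrable_const (c := (0:ℂ))).congr_uIoo fun t ht => by
      rw [uIoo_of_le hT] at ht; exact (kappaP_of_ge hν.ne' ht.1.le).symm
  rw [← intervalIntegral.integral_add_adjacent_intervals hi1 hi2, integral_kappaP_top_of_ge hν le_rfl hT,
    add_zero, integral_kappaP_self hν.ne' hk hy]

/-- **Dipole identity, `𝔤`-side, free top**: on `y < ν ≤ T`,
`conj(ϰ′ + iπS_j·ϰ + π²N_j·∫_y^T ϰ) = −(1/ν)·𝔤𝔥_{j,k}(ν − y)` (`T = 1`: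
`RepairKappaProfile.conj_kappa_gside_eq_ghT`). [cite: Zhang2022LandauSiegel, Lemma 8.4] -/
theorem conj_kappa_gside_top_eq_ghT (hk : k ≠ 0) (hν : 0 < ν) (hT : ν ≤ T) (j : ℕ) {y : ℝ}
    (hy : y < ν) :
    conj (kappaP' ν k y + I * π * ((bS j : ℝ) : ℂ) * kappaP ν k y
        + (π : ℂ) ^ 2 * ((bN j : ℝ) : ℂ) * ∫ t in y..T, kappaP ν k t)
      = -(((1 / ν : ℝ)) : ℂ) * ghT k j (ν - y) := by
  rw [integral_kappaP_top hk hν hT hy.le, kappaP'_of_lt hy, kappaP_of_le hy.le]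
  unfold kappaTail ghT ghR
  have hν' : (ν : ℂ) ≠ 0 := by exact_mod_cast hν.ne'
  have hπ : (π : ℂ) ≠ 0 := by exact_mod_cast Real.pi_ne_zero
  have hk' : (k : ℂ) ≠ 0 := by exact_mod_cast hk
  have hE : conj (cexp ((k : ℂ) * π * I * ((ν - y : ℝ) : ℂ)))
      = cexp (-((k : ℂ) * π * I * ((ν - y : ℝ) : ℂ))) := by
    rw [← Complex.exp_conj]
    congr 1
    simp [Complex.conj_ofReal]
  simp only [map_add, map_mul, map_sub, map_neg, map_div₀, map_one, map_pow, Complex.conj_ofReal,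
    Complex.conj_I, hE]
  push_cast
  field_simp
  ring

end Tail

/-! ### Formula I with free top on two `ϰ`-profiles: the pairing integral is the displayed one -/

section PairBlockTop

variable {νa νb ka kb T : ℝ}

/-- On the common support the top-`T` dipole integrand of two `ϰ`-profiles (`ν_b ≤ T`) is
`(ν_aν_b)⁻¹ 𝔣𝔣_{j,k_a}(ν_a−y)𝔤𝔥_{j,k_b}(ν_b−y)`. [cite: Zhang2022LandauSiegel, (8.11)–(8.12)] -/
theorem dipoleIntegrandTop_kappaP_of_lt (ha : 0 < νa) (hb : 0 < νb) (hbT : νb ≤ T) (hkb : kb ≠ 0)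
    (j : ℕ) {y : ℝ} (hya : y < νa) (hyb : y < νb) :
    dipoleIntegrandTop T j (kappaP νa ka) (kappaP' νa ka) (kappaP νb kb) (kappaP' νb kb) y
      = (((1 / (νa * νb) : ℝ)) : ℂ) * (ffT ka j (νa - y) * ghT kb j (νb - y)) := by
  unfold dipoleIntegrandTop
  rw [kappaP'_add_eq_ffT ha.ne' j hya, conj_kappa_gside_top_eq_ghT hkb hb hbT j hyb]
  push_cast
  ring

/-- Off the common support (on `[min ν, T]`) the top-`T` dipole integrand of two `ϰ`-profiles vanishes.
[cite: Zhang2022LandauSiegel, (2.27), (8.23), (9.7)] -/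
theorem dipoleIntegrandTop_kappaP_of_ge (ha : 0 < νa) (hb : 0 < νb) (j : ℕ) {y : ℝ}
    (hy : min νa νb ≤ y) (hyT : y ≤ T) :
    dipoleIntegrandTop T j (kappaP νa ka) (kappaP' νa ka) (kappaP νb kb) (kappaP' νb kb) y = 0 := by
  unfold dipoleIntegrandTop
  rcases le_total νa νb with hab | hab
  · rw [min_eq_left hab] at hy
    rw [kappaP'_of_ge hy, kappaP_of_ge ha.ne' hy]; ring
  · rw [min_eq_right hab] at hy
    rw [kappaP'_of_ge hy, kappaP_of_ge hb.ne' hy, integral_kappaP_top_of_ge hb hy hyT]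
    simp

/-- The top-`T` pairing integral of two components of lengths `ν_a, ν_b ≤ T` is
`(ν_aν_b)⁻¹ ∫₀^{min(ν_a,ν_b)} 𝔣𝔣_{j,k_a}(ν_a−u)𝔤𝔥_{j,k_b}(ν_b−u) du` — the top drops out. [cite: Zhang2022LandauSiegel, (8.11)–(8.12)] -/
theorem integral_dipoleIntegrandTop_kappaP (ha : 0 < νa) (hb : 0 < νb) (haT : νa ≤ T) (hbT : νb ≤ T)
    (hkb : kb ≠ 0) (j : ℕ) :
    ∫ y in (0:ℝ)..T, dipoleIntegrandTop T j (kappaP νa ka) (kappaP' νa ka) (kappaP νb kb) (kappaP' νb kb) y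
      = (((1 / (νa * νb) : ℝ)) : ℂ) *
          ∫ u in (0:ℝ)..min νa νb, ffT ka j (νa - u) * ghT kb j (νb - u) := by
  set m := min νa νb with hm
  have hm0 : 0 ≤ m := le_min ha.le hb.le
  have hmT : m ≤ T := (min_le_left _ _).trans haT
  have hF : Continuous fun u : ℝ => (((1 / (νa * νb) : ℝ)) : ℂ)
      * (ffT ka j (νa - u) * ghT kb j (νb - u)) := by unfold ffT ffR ghT ghR; fun_prop
  set D := dipoleIntegrandTop T j (kappaP νa ka) (kappaP' νa ka) (kappaP νb kb) (kappaP' νb kb)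
    with hD
  have hEq : EqOn D (fun u => (((1 / (νa * νb) : ℝ)) : ℂ)
      * (ffT ka j (νa - u) * ghT kb j (νb - u))) (uIoo 0 m) := by
    intro u hu
    rw [uIoo_of_le hm0] at hu
    exact dipoleIntegrandTop_kappaP_of_lt ha hb hbT hkb j (hu.2.trans_le (min_le_left _ _))
      (hu.2.trans_le (min_le_right _ _))
  have hEq0 : EqOn D (fun _ => (0:ℂ)) (uIoo m T) := by
    intro u hu
    rw [uIoo_of_le hmT] at hu
    exact dipoleIntegrandTop_kappaP_of_ge ha hb j hu.1.le hu.2.le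
  have hi1 : IntervalIntegrable D volume 0 m := (hF.intervalIntegrable 0 m).congr_uIoo hEq.symm
  have hi2 : IntervalIntegrable D volume m T :=
    (intervalIntegrable_const (c := (0:ℂ))).congr_uIoo hEq0.symm
  rw [← intervalIntegral.integral_add_adjacent_intervals hi1 hi2,
    intervalIntegral.integral_congr_uIoo hEq, intervalIntegral.integral_congr_uIoo hEq0,
    intervalIntegral.integral_zero, add_zero, intervalIntegral.integral_const_mul]

/-- **`M_T(ϰ_{ν,k}, ϰ_{ν,k}) = b(k, ν)` for EVERY length `0 < ν ≤ T`** (`k ≠ 0`): the top-`T` diagonal value of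
one piece is the tree's integral-defined `bDiagR k ν` ((8.19)/(8.20)/(9.3)/(9.4) at a general design); for
`ν ≤ 1 = T` this is `RepairPairFormGram.Mform_kappaP_diag`. [cite: Zhang2022LandauSiegel, (8.19)–(8.20), (9.3)–(9.4)] -/
theorem MformTop_kappaP_diag {ν k : ℝ} (hν : 0 < ν) (hT : ν ≤ T) (hk : k ≠ 0) :
    MformTop T (kappaP ν k) (kappaP' ν k) (kappaP ν k) (kappaP' ν k) = bDiagR k ν := by
  unfold MformTop bDiagR
  rw [integral_dipoleIntegrandTop_kappaP hν hν hT hT hk,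
    integral_dipoleIntegrandTop_kappaP hν hν hT hT hk,
    integral_dipoleIntegrandTop_kappaP hν hν hT hT hk, min_self]
  have e : ∀ j : ℕ, (∫ u in (0:ℝ)..ν, ffT k j (ν - u) * ghT k j (ν - u))
      = ∫ z in (0:ℝ)..ν, ffT k j z * ghT k j z := by
    intro j
    have := intervalIntegral.integral_comp_sub_left (fun z => ffT k j z * ghT k j z) ν
      (a := 0) (b := ν)
    simpa using this
  rw [e, e, e]
  unfold diagIntegrandR
  have c : ∀ j : ℕ, Continuous fun z => ffT k j z * ghT k j z := by
    intro j; unfold ffT ffR ghT ghR; fun_prop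
  rw [integral_wsum3 (c 1) (c 2) (c 3)]
  have hν' : (ν : ℂ) ≠ 0 := by exact_mod_cast hν.ne'
  have hπ : (π : ℂ) ≠ 0 := by exact_mod_cast Real.pi_ne_zero
  push_cast
  field_simp

/-- For lengths `ν ≤ 1` (and any top `T ≥ ν`) the top-`T` diagonal value IS formula I of record:
`M_T(ϰ,ϰ) = M(ϰ,ϰ)`. [cite: Zhang2022LandauSiegel, (8.19)–(8.20), (9.3)–(9.4)] -/
theorem MformTop_kappaP_diag_eq_Mform {ν k : ℝ} (hν : 0 < ν) (hν1 : ν ≤ 1) (hT : ν ≤ T) (hk : k ≠ 0) :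
    MformTop T (kappaP ν k) (kappaP' ν k) (kappaP ν k) (kappaP' ν k)
      = Mform (kappaP ν k) (kappaP' ν k) (kappaP ν k) (kappaP' ν k) := by
  rw [MformTop_kappaP_diag hν hT hk, Mform_kappaP_diag hν hν1 hk]

end PairBlockTop

/-! ### The continued one-sided diagonal form of a single piece -/

/-- **The continued diagonal form of one piece** `ϰ_{ν,k}` (top = support end `ν`):
`𝔅♯(k,ν) := M_ν(ϰ,ϰ) + conj M_ν(ϰ,ϰ)` — for `ν ≤ 1` the genuine main-term form `𝔅(ϰ_{ν,k})`
(`kappaDiagTop_eq_mainTermForm`), for `ν > 1` its continuation. [cite: Zhang2022LandauSiegel, (8.19)–(8.20), (9.3)–(9.4)] -/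
def kappaDiagTop (k ν : ℝ) : ℂ :=
  MformTop ν (kappaP ν k) (kappaP' ν k) (kappaP ν k) (kappaP' ν k)
    + conj (MformTop ν (kappaP ν k) (kappaP' ν k) (kappaP ν k) (kappaP' ν k))

/-- `𝔅♯(k,ν) = c(k,ν) = b + b̄` (`RepairFrakc12Theta.cDiagR`) for every `ν > 0`, `k ≠ 0`.
[cite: Zhang2022LandauSiegel, §8 after (8.23) p.50] -/
theorem kappaDiagTop_eq_cDiagR {k ν : ℝ} (hν : 0 < ν) (hk : k ≠ 0) : kappaDiagTop k ν = cDiagR k ν := by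
  unfold kappaDiagTop cDiagR; rw [MformTop_kappaP_diag hν le_rfl hk]

/-- **For `ν ≤ 1`, `𝔅♯(k,ν) = 𝔅(ϰ_{ν,k})`**, the PSD main-term form of `MainTermFormPSD` on the piece (Gram
identity `RepairFormulaIGram.mainTermFormPolar_eq_Mform`). [cite: Zhang2022LandauSiegel, (8.19)–(8.20), (9.3)–(9.4)] -/
theorem kappaDiagTop_eq_mainTermForm {k ν : ℝ} (hν : 0 < ν) (hν1 : ν ≤ 1) (hk : k ≠ 0) :
    kappaDiagTop k ν = (mainTermForm (kappaP ν k) (kappaP' ν k) : ℂ) := by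
  have kP := kinkedProfile_kappaP (k := k) hν hν1
  have h0 : kappaP ν k 1 = 0 := kappaP_one hν hν1
  rw [← mainTermFormPolar_self, mainTermFormPolar_eq_Mform kP kP h0 h0,
    ← MformTop_kappaP_diag_eq_Mform hν hν1 le_rfl hk]
  rfl

/-- **`𝔅♯(k,ν) ≥ 0` for every length `ν ≤ 1`** (`MainTermFormH1.mainTermForm_nonneg_of_isH1`) — the exhibit
below shows the bound `ν ≤ 1` cannot be moved to `21/20`. [cite: Zhang2022LandauSiegel, (8.19)–(8.20), (9.3)–(9.4)] -/
theorem kappaDiagTop_re_nonneg_of_le_one {k ν : ℝ} (hν : 0 < ν) (hν1 : ν ≤ 1) (hk : k ≠ 0) :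
    0 ≤ (kappaDiagTop k ν).re := by
  rw [kappaDiagTop_eq_mainTermForm hν hν1 hk, Complex.ofReal_re]
  exact mainTermForm_nonneg_of_isH1 (kinkedProfile_kappaP (k := k) hν hν1).isH1

/-- At rational data the continued form is the boxed functional `cDiag` of `RepairSection9Theta`.
[cite: Zhang2022LandauSiegel, §8 after (8.23) p.50] -/
theorem kappaDiagTop_ratCast (k : ℚ) {ν : ℝ} (hν : 0 < ν) (hk : k ≠ 0) :
    kappaDiagTop (k : ℝ) ν = cDiag k ν := by
  rw [kappaDiagTop_eq_cDiagR hν (by exact_mod_cast hk), cDiagR_ratCast]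

/-- **Control at the printed length `ν = 1/2`**: `𝔅♯(5/2, 1/2) = c₂₂` of (8.20)
(`1.322149 < c₂₂ < 1.32215`, `Section8Certificate.c22_re_bounds`). [cite: Zhang2022LandauSiegel, (8.20) p.49] -/
theorem kappaDiagTop_half_eq_c22 : kappaDiagTop (5/2) (1/2) = c22 := by
  have e : ((5/2 : ℚ) : ℝ) = (5/2 : ℝ) := by norm_num
  rw [c22_eq_cDiag, ← e, kappaDiagTop_ratCast (5/2) (by norm_num) (by norm_num)]
  norm_num

/-! ### Kernel certificates (boxes of `RepairSection9Boxes`, valid at every real length) -/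

/- Keep the interval primitives opaque to the elaborator's unifier (cf. `Section8Certificate`). -/
attribute [local irreducible] CB.add CB.sub CB.mul CB.neg CB.conj CB.mulFI CB.mulI CB.mulInt
  CB.ofFI CB.ofInt CB.normSqFI CB.expI FI.add FI.sub FI.mul FI.neg FI.mulInt FI.divNat FI.divPos
  FI.ofRat FI.ofInt FI.pi qCB piMul expIpi overPiFI piISq mulPiFI scaleRatFI recipFI
  recipMulPiFI expIpiFI

/-- leaf check over `ν ∈ [a, b]` (a point when `a = b`): flag and a rational bracket of `Re c(5/2, ν)`. [folklore] -/
def knifeOK (a b lo hi : ℚ) : Bool :=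
  bDiagOK (5/2) (FI.ofRatRat a b)
    && decide (lo * (SC : ℚ) < ((cDiagBL (5/2) (FI.ofRatRat a b)).re.lo : ℚ))
    && decide (((cDiagBL (5/2) (FI.ofRatRat a b)).re.hi : ℚ) < hi * (SC : ℚ))

/-- soundness of the leaf check. [cite: Moore1966, Theorem 3.1] -/
theorem knife_sound {a b lo hi : ℚ} (h : knifeOK a b lo hi = true) {ν : ℝ} (ha : (a : ℝ) ≤ ν)
    (hb : ν ≤ (b : ℝ)) : (lo : ℝ) < (cDiag (5/2) ν).re ∧ (cDiag (5/2) ν).re < (hi : ℝ) := by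
  simp only [knifeOK, Bool.and_eq_true, decide_eq_true_eq] at h
  obtain ⟨⟨hok, hlo⟩, hhi⟩ := h
  have hm := mem_cDiagBL (k := 5/2) (by norm_num) (FI.mem_ofRatRat ha hb) hok
  exact ⟨lo_bound hm.1 hlo, hi_bound hm.1 hhi⟩

/-- The certificate table (`decide +kernel`): brackets of `Re c(5/2, ν)` at `ν = 21/20, 1, 51/50, 11/10, 5/4, 2`
and over the box `[1.049, 1.051]` (inclusion property of the boxes). [cite: Moore1966, Theorem 3.1] -/
theorem knifeEdgeCert_holds :
    knifeOK (21/20) (21/20) (-0.04313) (-0.04311) = true ∧ knifeOK 1 1 0.19203 0.19204 = true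
      ∧ knifeOK (51/50) (51/50) 0.0971 0.0972 = true ∧ knifeOK (11/10) (11/10) (-0.263) (-0.2628) = true
      ∧ knifeOK (5/4) (5/4) (-0.7227) (-0.7226) = true ∧ knifeOK 2 2 (-1.9735) (-1.9734) = true
      ∧ knifeOK (1049/1000) (1051/1000) (-0.054) (-0.028) = true := by
  refine ⟨?_, ?_, ?_, ?_, ?_, ?_, ?_⟩ <;> decide +kernel

/-! ### The exhibit -/

/-- **LENGTH KNIFE EDGE — explicit witness in the manuscript's own shape.** One mollifier piece of the printed
`H₁₂`-type, `ϰ(y) = (1 − y/ν)e^{iπ(5/2)(ν−y)}` (twist `k₇ = 5/2` of `β₇ = 5iα/2`, (2.24)), `4 %` LONGER than `P`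
in the logarithmic scale (`ν = 21/20`), has a NEGATIVE continued diagonal main term:
`−0.04313 < 𝔅♯(5/2, 21/20) < −0.04311` (theory seat: `−0.0431`); the positivity every in-class evaluation enjoys
(`kappaDiagTop_re_nonneg_of_le_one`, `RepairPairFormGram.pairForm_re_nonneg`) stops at length `P`. **Caveat:**
`𝔅♯` at `ν > 1` is formula I's calculus continued, not a proved main term. [cite: Zhang2022LandauSiegel, Prop 7.1 p.44, (2.24) p.9] -/
theorem lengthKnifeEdge_witness :
    (-0.04313 : ℝ) < (kappaDiagTop (5/2) (21/20)).re ∧ (kappaDiagTop (5/2) (21/20)).re < -0.04311 := by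
  have h := knife_sound knifeEdgeCert_holds.1 le_rfl le_rfl
  rw [← kappaDiagTop_ratCast (5/2) (by norm_num) (by norm_num)] at h
  push_cast at h
  exact h

/-- `𝔅♯(5/2, 21/20) < 0`. [cite: Zhang2022LandauSiegel, Prop 7.1 p.44, (2.24) p.9] -/
theorem lengthKnifeEdge_witness_neg : (kappaDiagTop (5/2) (21/20)).re < 0 :=
  lengthKnifeEdge_witness.2.trans (by norm_num)

/-- **Control at `ν = 1` (length exactly `P`)**: `0.19203 < 𝔅(ϰ_{1,5/2}) < 0.19204`, a genuine (PSD) main-term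
form value (theory seat: `+0.192`). [cite: Zhang2022LandauSiegel, Prop 7.1 p.44, (2.24) p.9] -/
theorem lengthKnifeEdge_control_one :
    (0.19203 : ℝ) < mainTermForm (kappaP 1 (5/2)) (kappaP' 1 (5/2))
      ∧ mainTermForm (kappaP 1 (5/2)) (kappaP' 1 (5/2)) < 0.19204 := by
  have e : ((5/2 : ℚ) : ℝ) = (5/2 : ℝ) := by norm_num
  have h := knife_sound knifeEdgeCert_holds.2.1 le_rfl le_rfl
  have hre : (kappaDiagTop (5/2) 1).re = mainTermForm (kappaP 1 (5/2)) (kappaP' 1 (5/2)) := by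
    rw [kappaDiagTop_eq_mainTermForm one_pos le_rfl (by norm_num), Complex.ofReal_re]
  rw [← hre, ← e, kappaDiagTop_ratCast (5/2) one_pos (by norm_num)]
  push_cast at h
  exact ⟨by exact_mod_cast h.1, by exact_mod_cast h.2⟩

/-- More points of `ν ↦ 𝔅♯(5/2, ν)`: `> 0.0971` at `ν = 51/50`; `< −0.2628, −0.7226, −1.9734` at `ν = 11/10, 5/4, 2`
(theory seat's table `+0.097 / −0.263 / −0.723 / −1.97`). [cite: Zhang2022LandauSiegel, Prop 7.1 p.44, (2.24) p.9] -/
theorem lengthKnifeEdge_more :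
    (0.0971 : ℝ) < (kappaDiagTop (5/2) (51/50)).re ∧ (kappaDiagTop (5/2) (11/10)).re < -0.2628
      ∧ (kappaDiagTop (5/2) (5/4)).re < -0.7226 ∧ (kappaDiagTop (5/2) 2).re < -1.9734 := by
  obtain ⟨-, -, h2, h3, h4, h5, -⟩ := knifeEdgeCert_holds
  have g2 := (knife_sound h2 le_rfl le_rfl).1
  have g3 := (knife_sound h3 le_rfl le_rfl).2
  have g4 := (knife_sound h4 le_rfl le_rfl).2
  have g5 := (knife_sound h5 le_rfl le_rfl).2
  rw [← kappaDiagTop_ratCast (5/2) (by norm_num) (by norm_num)] at g2 g3 g4 g5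
  push_cast at g2 g3 g4 g5
  exact ⟨g2, g3, g4, g5⟩

/-- **A genuine interval statement** (one box): for EVERY length `ν ∈ [1.049, 1.051]`,
`𝔅♯(5/2, ν) < −0.028`. [cite: Zhang2022LandauSiegel, Prop 7.1 p.44, (2.24) p.9] -/
theorem lengthKnifeEdge_near {ν : ℝ} (h1 : (1.049 : ℝ) ≤ ν) (h2 : ν ≤ 1.051) :
    (kappaDiagTop (5/2) ν).re < -0.028 := by
  have hν : 0 < ν := by linarith
  have g := (knife_sound knifeEdgeCert_holds.2.2.2.2.2.2 (ν := ν) (by norm_num at h1 ⊢; exact h1)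
    (by norm_num at h2 ⊢; exact h2)).2
  rw [← kappaDiagTop_ratCast (5/2) hν (by norm_num)] at g
  push_cast at g
  exact g

end Repair

end Literature.NumberTheory.LFunctions.Zhang2022
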